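import Literature.Probability.RandomPlanarGeometry.SelfAvoidingWalk
import Literature.Probability.RandomPlanarGeometry.PolylineDyadicClock
import HarnessLib

/-!
# Line `past-shadowing-costs-halves` (crux `SAWLoopFugacityFlow.SimpleSubseqLimits`, stmt-CriticalPhenomena-4982),
stub `stub_decomposition` — part 1: the tail of a polyline on the dyadic clock

Helper file (lead prover, line `past-shadowing-costs-halves`, reshaped skeleton
`Cruxes/SimpleSubseqLimits/Lines/past_shadowing_costs_halves.lean`). The tree's polylines
(`LatticeModels.polyline`, hence `SimpleGraph.Walk.toCurve`) run on the DYADIC clock of iterated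
`Path.trans` (`PolylineDyadicClock.lean`: the `k`-th vertex of `a :: l` is passed at
`dyadicTime k = 1 - 2^{-k}`). This file adds the two facts the decomposition stub needs, stated
WITHOUT new definitions (the affine tail clock `x = 1 - 2^{-k} + 2^{-k} τ` is carried as an explicit
point `⟨_, dyadic_mem k τ⟩` of the unit interval):

* `polyline_dyadic_apply` — `polyline (a :: l) (1 - 2^{-k} + 2^{-k} τ) = polyline ((a :: l).drop k) τ`
  for `k ≤ l.length` (the polyline of the list with its first `k` points dropped is the original
  polyline on `[dyadicTime k, 1]`, affinely rescaled);
* `polyline_mem_of_le_dyadicTime` — if the first `k + 1` points of `a :: l` lie in a convex set `C`,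
  then `polyline (a :: l) s ∈ C` for every time `s ≤ dyadicTime k`;

with the elementary facts about the tail clock (`dyadic_mem`, monotonicity, surjectivity onto
`[dyadicTime k, 1]`).
-/

noncomputable section

open Set
open scoped unitInterval

namespace Summit.CriticalPhenomena.SAWScalingLimit.Theorems.SimpleSubseqLimits.PastShadowing.Clock

open Literature.Probability.LatticeModels
open Literature.Probability.RandomPlanarGeometry (dyadicTime coe_dyadicTime)

/-! ## The affine tail clock `τ ↦ 1 - 2^{-k} + 2^{-k} τ` -/

/-- The tail clock lands in the unit interval. [folklore] -/
theorem dyadic_mem (k : ℕ) (τ : I) : 1 - (1 / 2 : ℝ) ^ k + (1 / 2 : ℝ) ^ k * τ ∈ I := by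
  have h0 : 0 < (1 / 2 : ℝ) ^ k := by positivity
  have h1 : (1 / 2 : ℝ) ^ k ≤ 1 := pow_le_one₀ (by norm_num) (by norm_num)
  constructor
  · nlinarith [τ.2.1]
  · nlinarith [τ.2.2]

/-- **Registered anchor `stub_decompositionClock`** of this support file (line
`past-shadowing-costs-halves`, crux stmt-CriticalPhenomena-4982): the tail clock lands in the unit
interval. [folklore] -/
theorem stub_decompositionClock :
    ∀ (k : ℕ) (τ : I), 1 - (1 / 2 : ℝ) ^ k + (1 / 2 : ℝ) ^ k * (τ : ℝ) ∈ I :=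
  dyadic_mem

/-- At `τ = 0` the tail clock is `dyadicTime k`. [folklore] -/
theorem dyadic_zero (k : ℕ) : (⟨_, dyadic_mem k 0⟩ : I) = dyadicTime k :=
  Subtype.ext (by simp [coe_dyadicTime])

/-- For `k = 0` the tail clock is the identity. [folklore] -/
theorem dyadic_index_zero (τ : I) : (⟨_, dyadic_mem 0 τ⟩ : I) = τ := Subtype.ext (by simp)

/-- `dyadicTime k ≤ 1 - 2^{-k} + 2^{-k} τ`. [folklore] -/
theorem dyadicTime_le_dyadic (k : ℕ) (τ : I) : dyadicTime k ≤ ⟨_, dyadic_mem k τ⟩ := by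
  change (dyadicTime k : ℝ) ≤ 1 - (1 / 2 : ℝ) ^ k + (1 / 2 : ℝ) ^ k * τ
  rw [coe_dyadicTime]
  have : 0 ≤ (1 / 2 : ℝ) ^ k * τ := mul_nonneg (by positivity) τ.2.1
  linarith

/-- The tail clock is strictly monotone. [folklore] -/
theorem dyadic_strictMono (k : ℕ) : StrictMono fun τ : I => (⟨_, dyadic_mem k τ⟩ : I) := by
  intro τ τ' h
  change 1 - (1 / 2 : ℝ) ^ k + (1 / 2 : ℝ) ^ k * τ < 1 - (1 / 2 : ℝ) ^ k + (1 / 2 : ℝ) ^ k * τ'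
  have : (1 / 2 : ℝ) ^ k * τ < (1 / 2 : ℝ) ^ k * τ' :=
    mul_lt_mul_of_pos_left (Subtype.coe_lt_coe.2 h) (by positivity)
  linarith

/-- The successor tail clock is the right half of the `trans` clock. [folklore] -/
theorem coe_dyadic_succ (k : ℕ) (τ : I) :
    ((⟨_, dyadic_mem (k + 1) τ⟩ : I) : ℝ) = (1 + (⟨_, dyadic_mem k τ⟩ : I)) / 2 := by
  change 1 - (1 / 2 : ℝ) ^ (k + 1) + (1 / 2 : ℝ) ^ (k + 1) * τ =
    (1 + (1 - (1 / 2 : ℝ) ^ k + (1 / 2 : ℝ) ^ k * τ)) / 2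
  rw [pow_succ]
  ring

/-- Every time `x ≥ dyadicTime k` is a value of the tail clock. [folklore] -/
theorem exists_dyadic_eq {k : ℕ} {x : I} (hx : dyadicTime k ≤ x) :
    ∃ τ : I, (⟨_, dyadic_mem k τ⟩ : I) = x := by
  have hx' : 1 - (1 / 2 : ℝ) ^ k ≤ x := by rw [← coe_dyadicTime]; exact hx
  have h2 : 0 < (2 : ℝ) ^ k := by positivity
  have hhalf : (1 / 2 : ℝ) ^ k * (2 : ℝ) ^ k = 1 := by
    rw [← mul_pow]; norm_num
  refine ⟨⟨(2 : ℝ) ^ k * ((x : ℝ) - (1 - (1 / 2 : ℝ) ^ k)), ?_, ?_⟩, Subtype.ext ?_⟩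
  · exact mul_nonneg h2.le (by linarith)
  · have hx1 : (x : ℝ) ≤ 1 := x.2.2
    have : (2 : ℝ) ^ k * ((x : ℝ) - (1 - (1 / 2 : ℝ) ^ k)) = (2 : ℝ) ^ k * (x - 1) + 1 := by
      have : (2 : ℝ) ^ k * (1 / 2 : ℝ) ^ k = 1 := by rw [← mul_pow]; norm_num
      linear_combination this
    rw [this]
    nlinarith
  · change 1 - (1 / 2 : ℝ) ^ k + (1 / 2 : ℝ) ^ k * ((2 : ℝ) ^ k * ((x : ℝ) - (1 - (1 / 2 : ℝ) ^ k))) = x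
    rw [← mul_assoc, hhalf]
    ring

/-! ## The tail of a polyline is the polyline on `[dyadicTime k, 1]` -/

/-- Evaluating a `trans` on the right half: `(γ.trans γ') ((1 + t)/2) = γ' t`. [folklore] -/
theorem trans_apply_right_half {X : Type*} [TopologicalSpace X] {x y z : X} (γ : Path x y)
    (γ' : Path y z) (t : I) (s : I) (hs : (s : ℝ) = (1 + t) / 2) : (γ.trans γ') s = γ' t := by
  rw [Path.trans_apply]
  split_ifs with h
  · -- then `t = 0` and both sides are `y`
    have ht0 : (t : ℝ) = 0 := by linarith [t.2.1]
    have ht : t = 0 := Subtype.ext ht0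
    subst ht
    have h1 : (⟨2 * (s : ℝ), (unitInterval.mul_pos_mem_iff zero_lt_two).2 ⟨s.2.1, h⟩⟩ : I) = 1 :=
      Subtype.ext (by simp [hs])
    rw [h1, Path.target, Path.source]
  · congr 1
    apply Subtype.ext
    simp [hs]
    ring

variable {E : Type*} [AddCommGroup E] [Module ℝ E] [TopologicalSpace E] [ContinuousAdd E]
  [ContinuousSMul ℝ E]

/-- **The dyadic tail of `polyline`**: for `k ≤ l.length`, the polyline of `a :: l` at time
`1 - 2^{-k} + 2^{-k} τ` is the polyline of `(a :: l).drop k` at time `τ`. [folklore] -/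
theorem polyline_dyadic_apply :
    ∀ (k : ℕ) (a : E) (l : List E), k ≤ l.length → ∀ τ : I,
      polyline (a :: l) ⟨_, dyadic_mem k τ⟩ = polyline ((a :: l).drop k) τ
  | 0, a, l, _, τ => by rw [dyadic_index_zero]; rfl
  | k + 1, a, [], h, τ => by simp at h
  | k + 1, a, b :: l, h, τ => by
    have hk : k ≤ l.length := by simpa using h
    have IH := polyline_dyadic_apply k b l hk τ
    rw [List.drop_succ_cons, ← IH]
    change ((Path.segment a b).trans (polylineFrom b l).2) ⟨_, dyadic_mem (k + 1) τ⟩ =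
      (polylineFrom b l).2 ⟨_, dyadic_mem k τ⟩
    exact trans_apply_right_half _ _ _ _ (coe_dyadic_succ k τ)

/-- **Points of the polyline before time `dyadicTime k` lie in any convex set containing the first
`k + 1` vertices.** [folklore] -/
theorem polyline_mem_of_le_dyadicTime {C : Set E} (hC : Convex ℝ C) :
    ∀ (k : ℕ) (a : E) (l : List E), (∀ x ∈ (a :: l).take (k + 1), x ∈ C) →
      ∀ s : I, s ≤ dyadicTime k → polyline (a :: l) s ∈ C
  | 0, a, l, h, s, hs => by
    have hs0 : s = 0 := le_antisymm (by simpa using hs) bot_le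
    subst hs0
    rw [polyline_apply_zero]
    exact h a (by simp)
  | k + 1, a, [], h, s, _ => by
    have : polyline [a] s = a := by
      change (Path.refl a) s = a
      exact Path.refl_apply a s
    rw [this]
    exact h a (by simp)
  | k + 1, a, b :: l, h, s, hs => by
    have ha : a ∈ C := h a (by simp)
    have hb : b ∈ C := h b (by simp)
    have htail : ∀ x ∈ (b :: l).take (k + 1), x ∈ C := fun x hx =>
      h x (by rw [List.take_succ_cons]; exact List.mem_cons_of_mem a hx)
    change ((Path.segment a b).trans (polylineFrom b l).2) s ∈ C
    rw [Path.trans_apply]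
    split_ifs with hle
    · -- on the first segment
      rw [Path.segment_apply]
      refine hC.lineMap_mem ha hb ⟨?_, ?_⟩
      · change (0 : ℝ) ≤ 2 * (s : ℝ)
        nlinarith [s.2.1]
      · change 2 * (s : ℝ) ≤ 1
        have : (s : ℝ) ≤ 1 / 2 := hle
        linarith
    · -- on the tail, at time `2s - 1 ≤ dyadicTime k`
      have IH := polyline_mem_of_le_dyadicTime hC k b l htail
      change polyline (b :: l) _ ∈ C
      apply IH
      change (2 * (s : ℝ) - 1) ≤ (dyadicTime k : ℝ)
      have hs' : (s : ℝ) ≤ (dyadicTime (k + 1) : ℝ) := hs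
      rw [coe_dyadicTime] at hs' ⊢
      rw [pow_succ] at hs'
      nlinarith [pow_pos (show (0 : ℝ) < 1 / 2 by norm_num) k]

end Summit.CriticalPhenomena.SAWScalingLimit.Theorems.SimpleSubseqLimits.PastShadowing.Clock

end
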